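import Summits.ResolutionOfSingularities.ResolutionOfSingularities.Theorems.EquisingularLiftEquisingularLiftNatELNatAtQuadrics
import HarnessLib

/-!
# EL♮ (route currency) for a hypersurface may be checked in ANY linear coordinate system:
# `ELNatAt` for `(V₊(σ_{τ'} F), its embedding)` implies `ELNatAt` for every `(H, ι)` with `range ι = V₊(F)`

[OURS · leafhand-res-equisingularlift-6 g3, 2026-08-31; cell `pub/decomp-res`; items stmt-ResolutionOfSingularities-20038 / -20148] AI-produced, weaker than
expert review; NOT a statement of any manuscript; nothing here proves resolution of singularities.  DEF-FREE; no `sorry`; standard axioms; ZERO named hypotheses.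

The general form of the argument of ✓ `QuadricELNat.elNatAt_quadric` (p820083), for ALL degrees: the specimen theorems of the tree conclude EL♮ for hypersurfaces
in FIXED coordinates (`(hypersurface G, hypersurfaceι G)`); normal forms deliver `σ_{τ'} F = G` for an invertible linear substitution.  Here:

* ★ `elNatAt_of_elNatAt_linSubst` — for mutually inverse linear substitutions `τ, τ'` of `k[x₀, …, x_{n+1}]`, a closed immersion `ι : H ⟶ ℙⁿ⁺¹_k` with
  `range ι = V₊(F)`: `ELNatAt p k (n+1) (V₊(σ_{τ'} F)) ↪ → ELNatAt p k (n+1) H ι` (coefficient matrix `ḡ ∈ GL_{n+2}(k)` of `τ`,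
  ✓ `range_comp_projectiveSpaceLinAut`, ✓ `LinAutTransport.elNatAt_of_range_eq`, ✓ `LinAutTransport.elNatAt_of_elNatAt_comp_projLinAut`);
* `elNatAt_of_linSubst_isNonsingularForm` — if `σ_{τ'} F` is a nonsingular form of degree `d ≥ 1` (`n ≥ 1`), then `ELNatAt p k (n+1) H ι`
  (✓ `HypersurfaceSpecimen.elNatAt_smoothHypersurface`);
* `elNatAt_of_linSubst_linCone` — if `σ_{τ'} F = G(x_{ι 0}, …, x_{ι (m+1)})` is a cone with linear vertex `ℙʳ` over a NONSINGULAR form `G` of degree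
  `d ≥ 1` in `m + 2 ≥ 3` variables (complementary injections `ι, e`), then `ELNatAt p k (n+1) H ι` — ANY degree, any characteristic
  (✓ `LinCone.elNatAt_linCone_of_isNonsingularForm`): e.g. every integral hypersurface projectively equivalent to `x₀ᵈ + ⋯ + x_{m+1}ᵈ = 0` (`p ∤ d`) with
  a linear vertex.

Honest reading: plumbing for future normal-form arguments (cubics onwards); closes no registered stub.
-/

set_option linter.dupNamespace false -- mandated namespace `Summit.<Summit>.<Problem>` of this single-conjunct summit

noncomputable section

open CategoryTheory CategoryTheory.Limits AlgebraicGeometry TopologicalSpace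
open MvPolynomial HomogeneousIdeal
open Literature.AlgebraicGeometry.Resolution Literature.AlgebraicGeometry.Motives
open Literature.AlgebraicGeometry.Motives.SmoothHypersurface
open Literature.AlgebraicGeometry.Motives.ProjectiveSpaceCells
open Literature.AlgebraicGeometry.GroupSchemes.ProjLinAction
open Summit.ResolutionOfSingularities.ResolutionOfSingularities.Theorems.EquisingularLift
open Summit.ResolutionOfSingularities.ResolutionOfSingularities.Cruxes.EquisingularLift.StrataSplit

namespace Summit.ResolutionOfSingularities.ResolutionOfSingularities.Cruxes.EquisingularLiftNat.Sections

namespace QuadricELNat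

variable {k : Type} [Field k] {n : ℕ} (τ τ' : Fin (n + 1 + 1) → MvPolynomial (Fin (n + 1 + 1)) k)
  (hτ : ∀ i, (τ i).IsHomogeneous 1) (hτ' : ∀ i, (τ' i).IsHomogeneous 1)
  (hinv : ∀ i, aeval τ (τ' i) = X i) (hinv' : ∀ i, aeval τ' (τ i) = X i)

include hτ hτ' hinv hinv' in
/-- ★ **EL♮ may be checked in any linear coordinate system.**  For mutually inverse linear substitutions `τ, τ'` and a closed immersion
`ι : H ⟶ ℙⁿ⁺¹_k` with `range ι = V₊(F)`: if `Theorems.EquisingularLift.ELNatAt` holds for the hypersurface `V₊(σ_{τ'} F)` with its embedding, it holds for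
`(H, ι)`.  The coefficient matrix `ḡ` of `τ` lies in `GL_{n+2}(k)` with inverse that of `τ'` (`coeffMatrix_mul_eq_one`), `range (ι ≫ α_ḡ) = V₊(σ_{τ'} F)`
(`range_comp_projectiveSpaceLinAut`, `linSubst_coeff_apply`), and EL♮ travels along `α_ḡ` (✓ `LinAutTransport.elNatAt_of_elNatAt_comp_projLinAut`).
[OURS · DEF-FREE] [cite: Hartshorne1977, II Example 7.1.1] -/
theorem elNatAt_of_elNatAt_linSubst (p : ℕ) [CharP k p] [IsAlgClosed k]
    {H : Scheme.{0}} (ι : H ⟶ (projectiveSpace (n + 1) k).left) [IsClosedImmersion ι] (F : MvPolynomial (Fin (n + 1 + 1)) k)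
    (hrange : letI := MvPolynomial.gradedAlgebra (σ := Fin (n + 1 + 1)) (R := k)
      Set.range ι = {x : Proj (homogeneousSubmodule (Fin (n + 1 + 1)) k) | F ∈ x.asHomogeneousIdeal})
    (h : ELNatAt p k (n + 1) (hypersurface (aeval τ' F)).left (hypersurfaceι (aeval τ' F)).left) :
    ELNatAt p k (n + 1) H ι := by
  classical
  letI := MvPolynomial.gradedAlgebra (σ := Fin (n + 1 + 1)) (R := k)
  have hrange' : Set.range ι = {x : (projectiveSpace (n + 1) k).left | F ∈ x.asHomogeneousIdeal} := hrange
  have h1 : (Matrix.of fun i j => coeff (Finsupp.single j 1) (τ i)) * (Matrix.of fun i j => coeff (Finsupp.single j 1) (τ' i)) =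
      (1 : Matrix (Fin (n + 1 + 1)) (Fin (n + 1 + 1)) k) := coeffMatrix_mul_eq_one τ' τ hτ hinv'
  have h2 : (Matrix.of fun i j => coeff (Finsupp.single j 1) (τ' i)) * (Matrix.of fun i j => coeff (Finsupp.single j 1) (τ i)) =
      (1 : Matrix (Fin (n + 1 + 1)) (Fin (n + 1 + 1)) k) := coeffMatrix_mul_eq_one τ τ' hτ' hinv
  let gk : GL (Fin (n + 1 + 1)) k :=
    ⟨Matrix.of fun i j => coeff (Finsupp.single j 1) (τ i), Matrix.of fun i j => coeff (Finsupp.single j 1) (τ' i), h1, h2⟩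
  have hginv : ((gk⁻¹ : GL (Fin (n + 1 + 1)) k) : Matrix (Fin (n + 1 + 1)) (Fin (n + 1 + 1)) k) =
      Matrix.of fun i j => coeff (Finsupp.single j 1) (τ' i) := rfl
  have hrange₁ : Set.range (ι ≫ (projectiveSpaceLinAut (n + 1) k gk).hom.left) =
      {x : (projectiveSpace (n + 1) k).left | aeval τ' F ∈ x.asHomogeneousIdeal} := by
    rw [range_comp_projectiveSpaceLinAut gk ι F hrange', hginv, linSubst_coeff_apply τ' hτ']
  refine LinAutTransport.elNatAt_of_elNatAt_comp_projLinAut p k (n + 1) H ι gk ?_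
  refine LinAutTransport.elNatAt_of_range_eq p k (n + 1) _ (hypersurfaceι (aeval τ' F)).left ?_ h
  rw [hrange₁, setOf_mem_eq_range_hypersurfaceι]

include hτ hτ' hinv hinv' in
/-- **EL♮ for a hypersurface which is SMOOTH IN SOME LINEAR COORDINATES**: if `σ_{τ'} F` is a nonsingular form of degree `d ≥ 1` (`n ≥ 1`), then every
`(H, ι)` with `range ι = V₊(F)` satisfies `ELNatAt p k (n + 1) H ι` (✓ `HypersurfaceSpecimen.elNatAt_smoothHypersurface` + `elNatAt_of_elNatAt_linSubst`).
[OURS · DEF-FREE] [cite: Hartshorne1977, I Ex. 5.8] -/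
theorem elNatAt_of_linSubst_isNonsingularForm (p : ℕ) (hp : p.Prime) [CharP k p] [IsAlgClosed k] (hn : 1 ≤ n)
    {H : Scheme.{0}} (ι : H ⟶ (projectiveSpace (n + 1) k).left) [IsClosedImmersion ι] (F : MvPolynomial (Fin (n + 1 + 1)) k)
    {d : ℕ} (hF : (aeval τ' F).IsHomogeneous d) (hd : 1 ≤ d) (hns : IsNonsingularForm k (aeval τ' F))
    (hrange : letI := MvPolynomial.gradedAlgebra (σ := Fin (n + 1 + 1)) (R := k)
      Set.range ι = {x : Proj (homogeneousSubmodule (Fin (n + 1 + 1)) k) | F ∈ x.asHomogeneousIdeal}) :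
    ELNatAt p k (n + 1) H ι :=
  elNatAt_of_elNatAt_linSubst τ τ' hτ hτ' hinv hinv' p ι F hrange
    (HypersurfaceSpecimen.elNatAt_smoothHypersurface p hp k hn (aeval τ' F) hF hd hns)

include hτ hτ' hinv hinv' in
/-- **EL♮ for a hypersurface which is, IN SOME LINEAR COORDINATES, a cone with linear vertex over a nonsingular form** — any degree `d ≥ 1`, any
characteristic: `σ_{τ'} F = G(x_{ι 0}, …, x_{ι (m+1)})`, `G` nonsingular in `m + 2 ≥ 3` variables, `e` the complementary `r + 1` vertex variables
(✓ `LinCone.elNatAt_linCone_of_isNonsingularForm` + `elNatAt_of_elNatAt_linSubst`). [OURS · DEF-FREE] [cite: Hartshorne1977, I Ex. 5.12] -/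
theorem elNatAt_of_linSubst_linCone (p : ℕ) (hp : p.Prime) [CharP k p] [IsAlgClosed k] {r m : ℕ} (hm : 1 ≤ m)
    (ιm : Fin (m + 2) → Fin (n + 2)) (hιm : Function.Injective ιm) (e : Fin (r + 1) → Fin (n + 2)) (he : Function.Injective e)
    (hιe : ∀ l, ιm l ∉ Set.range e) (heι : ∀ a, a ∉ Set.range e → a ∈ Set.range ιm)
    (G : MvPolynomial (Fin (m + 2)) k) {d : ℕ} (hG : G.IsHomogeneous d) (hd : 1 ≤ d) (hGns : IsNonsingularForm k G)
    {H : Scheme.{0}} (ι : H ⟶ (projectiveSpace (n + 1) k).left) [IsClosedImmersion ι] (F : MvPolynomial (Fin (n + 1 + 1)) k)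
    (hFG : aeval τ' F = rename ιm G)
    (hrange : letI := MvPolynomial.gradedAlgebra (σ := Fin (n + 1 + 1)) (R := k)
      Set.range ι = {x : Proj (homogeneousSubmodule (Fin (n + 1 + 1)) k) | F ∈ x.asHomogeneousIdeal}) :
    ELNatAt p k (n + 1) H ι := by
  refine elNatAt_of_elNatAt_linSubst τ τ' hτ hτ' hinv hinv' p ι F hrange ?_
  rw [hFG]
  exact LinCone.elNatAt_linCone_of_isNonsingularForm p hp k hm ιm hιm e he hιe heι G hG hd hGns

end QuadricELNat

end Summit.ResolutionOfSingularities.ResolutionOfSingularities.Cruxes.EquisingularLiftNat.Sections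

end
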